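import Summits.CriticalPhenomena.CardyFormulaZ2.Theorems.HalfPlaneMarkDensityLaw.Negative.MarkEvents
import Literature.Probability.Percolation.Z2HalfPlaneThreeArm
import Literature.Probability.Percolation.FiniteEnergy
import Literature.Probability.Percolation.HalfSpaceBrickUp

/-!
# Legs/thinning inequality for the half-plane arc-crossing function (stub `legs_thinning`)

Support for crux stmt-CriticalPhenomena-5661 (`HalfPlaneMarkDensityLaw`), line Sketch, Stage II
(bottom-row insensitivity of the half-plane crossing probabilities of bond-`ℤ²` at `p = 1/2`).
With `Ray = (−∞,−X] × {0}`, `Cross = {Ray ↔ [1,S] × {0} in H}` (`H = {x₁ ≥ 0}`) and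
`Legged = {∃ a ≤ −X, b ∈ [0,S] : the legs at a and b are open and (a,0) ↔ (b,0) in H}` we prove
`P(Cross) − P(Legged) ≤ P(FewR) + P(FewL) + 2 · 2^{−(M+1)}`, where `Few*` says that the
`H`-cluster of the least `r ∈ [1,S]` joined to the ray inside `H` contains at most `M` sites of
the target arc `[0,S] × {0}` (resp. of the ray window `[−X−W,−X] × {0}`).

Proof: on `Cross ∖ Legged` that cluster has all its legs closed on the target arc or on the ray
window; the cluster is determined by the half-plane edges (`determinedBy_openConnIn_halfPlane`),
the legs are not half-plane edges, so conditionally on the half-plane configuration they are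
independent fair coins (`bondPercolation_real_inter_memDep_le`): more than `M` closed legs cost
`2^{−(M+1)}`.
-/

noncomputable section
namespace Summit.CriticalPhenomena.CardyFormulaZ2.Cruxes.HalfPlaneMarkDensityLaw.SketchLine.SelfDual
open Literature.Probability.Percolation Literature.Probability.LatticeModels
open Literature.Probability.Percolation.Z2HalfPlane (leg adj_leg)
open MeasureTheory Filter Set SimpleGraph
open Summit.CriticalPhenomena.CardyFormulaZ2.Theorems.HalfPlaneMarkDensityLaw.Negative

namespace LegsThinning

/-! ### Locality of half-plane connection events -/

/-- `{x ↔ y in H}` depends only on the half-plane edges: an open path inside `H` uses only edges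
with both endpoints in `H`. [folklore] -/
private theorem determinedBy_openConnIn_halfPlane (x y : Site 2) :
    DeterminedBy (openConnIn halfPlane x y) Z2HalfPlane.hpEdges := by
  rw [determinedBy_iff]
  intro ω ω' h
  have key : (openGraph ω).induce halfPlane = (openGraph ω').induce halfPlane := by
    ext u v
    simp only [SimpleGraph.comap_adj, Function.Embedding.coe_subtype, openGraph_adj]
    have hmem : s(u.1, v.1) ∈ Z2HalfPlane.hpEdges := by
      intro w hw
      rcases Sym2.mem_iff.1 hw with rfl | rfl
      · exact u.2
      · exact v.2
    have hiff : s(u.1, v.1) ∈ ω ↔ s(u.1, v.1) ∈ ω' :=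
      ⟨fun h1 => ((Set.ext_iff.1 h _).1 ⟨h1, hmem⟩).1,
        fun h1 => ((Set.ext_iff.1 h _).2 ⟨h1, hmem⟩).1⟩
    rw [hiff]
  simp only [openConnIn, Set.mem_setOf_eq, key]

/-- Arc-crossing events of `H` depend only on the half-plane edges. [folklore] -/
private theorem determinedBy_openCrossing_halfPlane (A B : Set (Site 2)) :
    DeterminedBy (openCrossing halfPlane A B) Z2HalfPlane.hpEdges := by
  rw [determinedBy_iff]
  intro ω ω' h
  simp only [mem_openCrossing_iff,
    fun x y => (determinedBy_iff _ _).1 (determinedBy_openConnIn_halfPlane x y) ω ω' h]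

/-- All legs over a finite set of abscissae are closed with probability `2^{-|F|}` (legs are
lattice edges, `P_{1/2}` is a product measure). [folklore] -/
private theorem real_forall_leg_notMem (F : Finset ℤ) :
    μ.real {ω : BondConfig (Site 2) | ∀ e ∈ F.image leg, e ∉ ω} = (1 / 2 : ℝ) ^ F.card := by
  have hsub : (↑(F.image leg) : Set (Sym2 (Site 2))) ⊆ (zdGraph 2).edgeSet := fun e he => by
    obtain ⟨c, -, rfl⟩ := Finset.mem_image.1 (Finset.mem_coe.1 he)
    exact (SimpleGraph.mem_edgeSet _).2 (adj_leg c)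
  rw [show μ = bondPercolation (zdGraph 2) half from rfl,
    BGN.bondPercolation_real_forall_notMem_eq _ _ _ hsub,
    Finset.card_image_of_injective _ Z2HalfPlane.leg_injective, coe_half]
  norm_num

/-! ### Thinning: many touches with all legs closed is unlikely -/

/-- **Thinning by independent legs.** If the events `T c` ("`(c,0)` belongs to the cluster") are
measurable and determined by the half-plane edges, then the probability that more than `M` points
`c ∈ I` satisfy `T c` while all their legs are closed is at most `2^{-(M+1)}`: conditionally on the
half-plane configuration the legs are independent fair coins. [folklore] -/
private theorem real_manyTouches_allClosed_le (T : ℤ → Set (BondConfig (Site 2))) (I : Finset ℤ)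
    (M : ℕ) (hTm : ∀ c, MeasurableSet (T c)) (hTd : ∀ c, DeterminedBy (T c) Z2HalfPlane.hpEdges) :
    μ.real {ω | M < {c : ℤ | c ∈ I ∧ ω ∈ T c}.ncard ∧ ∀ c ∈ I, ω ∈ T c → leg c ∉ ω} ≤
      (1 / 2 : ℝ) ^ (M + 1) := by
  classical
  -- the statistic `Ψ ω`: the points of the window whose event holds
  obtain ⟨Ψ, hΨ⟩ : ∃ Ψ : BondConfig (Site 2) → Finset ℤ, ∀ ω, Ψ ω = I.filter fun c => ω ∈ T c :=
    ⟨_, fun _ => rfl⟩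
  have hcoe : ∀ ω, {c : ℤ | c ∈ I ∧ ω ∈ T c} = ↑(Ψ ω) := fun ω => by
    ext c; simp [hΨ]
  have hsub : {ω | M < {c : ℤ | c ∈ I ∧ ω ∈ T c}.ncard ∧ ∀ c ∈ I, ω ∈ T c → leg c ∉ ω} ⊆
      {ω | M < (Ψ ω).card} ∩ {ω | ∀ e ∈ (Ψ ω).image leg, e ∉ ω} := by
    rintro ω ⟨hM, hleg⟩
    refine ⟨?_, fun e he => ?_⟩
    · rw [hcoe, Set.ncard_coe_finset] at hM
      exact hM
    · obtain ⟨c, hc, rfl⟩ := Finset.mem_image.1 he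
      rw [hΨ, Finset.mem_filter] at hc
      exact hleg c hc.1 hc.2
  -- `Ψ` depends only on the half-plane edges
  have hΨcongr : ∀ ω ω' : BondConfig (Site 2),
      ω ∩ Z2HalfPlane.hpEdges = ω' ∩ Z2HalfPlane.hpEdges → Ψ ω = Ψ ω' := fun ω ω' h => by
    rw [hΨ, hΨ]
    exact Finset.filter_congr fun c _ => (determinedBy_iff _ _).1 (hTd c) ω ω' h
  have hdet : ∀ F, DeterminedBy ({ω | M < (Ψ ω).card} ∩ Ψ ⁻¹' {F}) Z2HalfPlane.hpEdges := by
    intro F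
    rw [determinedBy_iff]
    intro ω ω' h
    simp only [Set.mem_inter_iff, Set.mem_setOf_eq, Set.mem_preimage, Set.mem_singleton_iff,
      hΨcongr ω ω' h]
  -- measurability of the pieces
  have hpre : ∀ F, MeasurableSet (Ψ ⁻¹' {F}) := fun F => by
    have : Ψ ⁻¹' {F} = {ω | ∀ c : ℤ, (c ∈ I ∧ ω ∈ T c ↔ c ∈ F)} := by
      ext ω
      simp only [Set.mem_preimage, Set.mem_singleton_iff, Set.mem_setOf_eq, hΨ, Finset.ext_iff,
        Finset.mem_filter]
    rw [this]
    refine measurableSet_setOf.2 ?_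
    fun_prop (disch := exact hTm _)
  have hAm : MeasurableSet {ω | M < (Ψ ω).card} := by
    have : {ω | M < (Ψ ω).card} = ⋃ F ∈ I.powerset.filter (fun F => M < F.card), Ψ ⁻¹' {F} := by
      ext ω
      simp only [Set.mem_setOf_eq, Set.mem_iUnion, Set.mem_preimage, Set.mem_singleton_iff,
        Finset.mem_filter, Finset.mem_powerset, exists_prop]
      refine ⟨fun h => ⟨Ψ ω, ⟨?_, h⟩, rfl⟩, fun ⟨F, ⟨_, hF⟩, hΨF⟩ => hΨF ▸ hF⟩
      rw [hΨ]; exact Finset.filter_subset _ _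
    rw [this]
    exact Finset.measurableSet_biUnion _ fun F _ => hpre F
  -- conditional independence of the legs given the half-plane configuration
  have key := bondPercolation_real_inter_memDep_le (zdGraph 2) half (A := {ω | M < (Ψ ω).card})
    (fun _ => Z2HalfPlane.hpEdges) (fun F => (↑(F.image leg) : Set (Sym2 (Site 2)))) Ψ
    (fun F => {ω | ∀ e ∈ F.image leg, e ∉ ω}) hdet (fun F => hAm.inter (hpre F))
    (fun F => determinedBy_forall_notMem (F.image leg))
    (fun F => measurableSet_forall_notMem (F.image leg))
    (fun ω _ => Set.disjoint_right.2 fun e he => by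
      -- legs are not half-plane edges: their lower end is below the boundary line
      obtain ⟨c, -, rfl⟩ := Finset.mem_image.1 (Finset.mem_coe.1 he)
      intro h
      have h1 := h ![c, -1] (Sym2.mem_mk_left _ _)
      simp at h1)
    (q := (1 / 2 : ℝ) ^ (M + 1)) fun ω hω => by
      have hω : M < (Ψ ω).card := hω
      show μ.real {ω' | ∀ e ∈ (Ψ ω).image leg, e ∉ ω'} ≤ _
      rw [real_forall_leg_notMem]
      exact pow_le_pow_of_le_one (by norm_num) (by norm_num) hω
  calc μ.real {ω | M < {c : ℤ | c ∈ I ∧ ω ∈ T c}.ncard ∧ ∀ c ∈ I, ω ∈ T c → leg c ∉ ω}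
      ≤ μ.real ({ω | M < (Ψ ω).card} ∩ {ω | ∀ e ∈ (Ψ ω).image leg, e ∉ ω}) :=
        measureReal_mono hsub
    _ ≤ (1 / 2 : ℝ) ^ (M + 1) * μ.real {ω | M < (Ψ ω).card} := key
    _ ≤ (1 / 2 : ℝ) ^ (M + 1) * 1 := by gcongr; exact measureReal_le_one
    _ = (1 / 2 : ℝ) ^ (M + 1) := mul_one _

/-! ### The first touch point of the ray cluster on `[1, S]` -/

/-- The least touch point is unique. [folklore] -/
private theorem firstTouch_unique {Ray : Set (Site 2)} {ω : BondConfig (Site 2)} {r r' : ℤ}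
    (h1 : 1 ≤ r) (hr : ω ∈ openCrossing halfPlane Ray {bpt r})
    (hmin : ∀ t : ℤ, 1 ≤ t → t < r → ω ∉ openCrossing halfPlane Ray {bpt t})
    (h1' : 1 ≤ r') (hr' : ω ∈ openCrossing halfPlane Ray {bpt r'})
    (hmin' : ∀ t : ℤ, 1 ≤ t → t < r' → ω ∉ openCrossing halfPlane Ray {bpt t}) : r = r' := by
  rcases lt_trichotomy r r' with h | h | h
  · exact absurd hr (hmin' r h1 h)
  · exact h
  · exact absurd hr' (hmin r' h1' h)

/-- On `{Ray ↔ [1,S] × {0} in H}` there is a least `r ∈ [1,S]` with `Ray ↔ (r,0)` in `H`.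
[folklore] -/
private theorem exists_firstTouch {Ray : Set (Site 2)} {S : ℤ} {ω : BondConfig (Site 2)}
    (h : ω ∈ openCrossing halfPlane Ray (rowIcc 1 S)) :
    ∃ r : ℤ, 1 ≤ r ∧ r ≤ S ∧ ω ∈ openCrossing halfPlane Ray {bpt r} ∧
      ∀ r' : ℤ, 1 ≤ r' → r' < r → ω ∉ openCrossing halfPlane Ray {bpt r'} := by
  obtain ⟨x, hx, y, ⟨hy1, hy0, hyS⟩, hxy⟩ := h
  have hy : y = bpt (y 0) := (site_eq_bpt_iff y (y 0)).2 ⟨hy1, rfl⟩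
  obtain ⟨r, ⟨h1, hS, hr⟩, hmin⟩ := Int.exists_least_of_bdd
    (P := fun z => 1 ≤ z ∧ z ≤ S ∧ ω ∈ openCrossing halfPlane Ray {bpt z})
    ⟨1, fun z hz => hz.1⟩ ⟨y 0, hy0, hyS, x, hx, y, Set.mem_singleton_iff.2 hy, hxy⟩
  exact ⟨r, h1, hS, hr, fun r' h1' hlt hr' => by have := hmin r' ⟨h1', by omega, hr'⟩; omega⟩

/-- **One-sided thinning bound.** The event "the `H`-cluster of the first touch point has all
its legs over the window `[lo, hi]` closed" has probability at most
`P[that cluster meets the window in ≤ M sites] + 2^{-(M+1)}`. [folklore] -/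
private theorem real_allLegsClosed_le (Ray : Set (Site 2)) (S lo hi : ℤ) (M : ℕ) :
    μ.real {ω | ∃ r : ℤ, 1 ≤ r ∧ r ≤ S ∧ ω ∈ openCrossing halfPlane Ray {bpt r} ∧
        (∀ r' : ℤ, 1 ≤ r' → r' < r → ω ∉ openCrossing halfPlane Ray {bpt r'}) ∧
        ∀ c : ℤ, lo ≤ c → c ≤ hi → ω ∈ openConnIn halfPlane (bpt r) (bpt c) → leg c ∉ ω} ≤
      μ.real {ω | ∃ r : ℤ, 1 ≤ r ∧ r ≤ S ∧ ω ∈ openCrossing halfPlane Ray {bpt r} ∧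
        (∀ r' : ℤ, 1 ≤ r' → r' < r → ω ∉ openCrossing halfPlane Ray {bpt r'}) ∧
        {c : ℤ | lo ≤ c ∧ c ≤ hi ∧ ω ∈ openConnIn halfPlane (bpt r) (bpt c)}.ncard ≤ M} +
      (1 / 2 : ℝ) ^ (M + 1) := by
  -- `T c`: `(c,0)` is joined inside `H` to the first touch point
  obtain ⟨T, hT⟩ : ∃ T : ℤ → Set (BondConfig (Site 2)), ∀ c, T c = {ω | ∃ r : ℤ, 1 ≤ r ∧ r ≤ S ∧
      ω ∈ openCrossing halfPlane Ray {bpt r} ∧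
      (∀ r' : ℤ, 1 ≤ r' → r' < r → ω ∉ openCrossing halfPlane Ray {bpt r'}) ∧
      ω ∈ openConnIn halfPlane (bpt r) (bpt c)} := ⟨_, fun _ => rfl⟩
  have hTm : ∀ c, MeasurableSet (T c) := fun c => by
    rw [hT]
    refine measurableSet_setOf.2 ?_
    fun_prop (disch := first
      | exact measurableSet_openCrossing_of_countable _ _ _
      | exact measurableSet_openConnIn_of_countable _ _ _)
  have hTd : ∀ c, DeterminedBy (T c) Z2HalfPlane.hpEdges := fun c => by
    rw [hT, determinedBy_iff]
    intro ω ω' h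
    simp only [Set.mem_setOf_eq,
      fun A B => (determinedBy_iff _ _).1 (determinedBy_openCrossing_halfPlane A B) ω ω' h,
      fun x y => (determinedBy_iff _ _).1 (determinedBy_openConnIn_halfPlane x y) ω ω' h]
  -- by uniqueness of the first touch point, `T c` is the indicator of its cluster
  have hsub : {ω | ∃ r : ℤ, 1 ≤ r ∧ r ≤ S ∧ ω ∈ openCrossing halfPlane Ray {bpt r} ∧
        (∀ r' : ℤ, 1 ≤ r' → r' < r → ω ∉ openCrossing halfPlane Ray {bpt r'}) ∧
        ∀ c : ℤ, lo ≤ c → c ≤ hi → ω ∈ openConnIn halfPlane (bpt r) (bpt c) → leg c ∉ ω} ⊆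
      {ω | ∃ r : ℤ, 1 ≤ r ∧ r ≤ S ∧ ω ∈ openCrossing halfPlane Ray {bpt r} ∧
        (∀ r' : ℤ, 1 ≤ r' → r' < r → ω ∉ openCrossing halfPlane Ray {bpt r'}) ∧
        {c : ℤ | lo ≤ c ∧ c ≤ hi ∧ ω ∈ openConnIn halfPlane (bpt r) (bpt c)}.ncard ≤ M} ∪
      {ω | M < {c : ℤ | c ∈ Finset.Icc lo hi ∧ ω ∈ T c}.ncard ∧
        ∀ c ∈ Finset.Icc lo hi, ω ∈ T c → leg c ∉ ω} := by
    rintro ω ⟨r, h1, hS, hr, hmin, H⟩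
    have key : ∀ c, ω ∈ T c ↔ ω ∈ openConnIn halfPlane (bpt r) (bpt c) := fun c => by
      rw [hT]
      refine ⟨fun h => ?_, fun hc => ⟨r, h1, hS, hr, hmin, hc⟩⟩
      obtain ⟨r', h1', -, hr', hmin', hc⟩ := h
      obtain rfl := firstTouch_unique h1 hr hmin h1' hr' hmin'
      exact hc
    have hset : {c : ℤ | c ∈ Finset.Icc lo hi ∧ ω ∈ T c} =
        {c : ℤ | lo ≤ c ∧ c ≤ hi ∧ ω ∈ openConnIn halfPlane (bpt r) (bpt c)} := by
      ext c; simp only [Set.mem_setOf_eq, Finset.mem_Icc, key, and_assoc]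
    by_cases hM : {c : ℤ | lo ≤ c ∧ c ≤ hi ∧ ω ∈ openConnIn halfPlane (bpt r) (bpt c)}.ncard ≤ M
    · exact Or.inl ⟨r, h1, hS, hr, hmin, hM⟩
    · refine Or.inr ⟨?_, fun c hc hTc => ?_⟩
      · rw [hset]; exact not_le.1 hM
      · exact H c (Finset.mem_Icc.1 hc).1 (Finset.mem_Icc.1 hc).2 ((key c).1 hTc)
  exact (measureReal_mono hsub).trans ((measureReal_union_le _ _).trans
    (add_le_add le_rfl (real_manyTouches_allClosed_le T _ M hTm hTd)))

end LegsThinning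

/-! ### The inequality -/

/-- **Legs/thinning inequality** (bottom-row insensitivity, exact form): with
`Ray = (−∞,−X] × {0}`, `P[Ray ↔ [1,S] × {0} in H] − P[Legged] ≤ P[FewR] + P[FewL] + 2·2^{−(M+1)}`,
where `Legged = {∃ a ≤ −X, 0 ≤ b ≤ S : legs at a, b open, (a,0) ↔ (b,0) in H}` and `FewR`
(resp. `FewL`) says that the `H`-cluster of the least `r ∈ [1,S]` joined to the ray in `H` meets
`[0,S] × {0}` (resp. `[−X−W,−X] × {0}`) in at most `M` sites.  On `Cross ∖ Legged` that cluster
has all its legs closed on one of the two windows, and more than `M` closed legs conditionally on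
the half-plane configuration cost `2^{−(M+1)}` (`LegsThinning.real_allLegsClosed_le`).
[folklore] -/
theorem legs_thinning : ∀ (X S : ℤ) (M W : ℕ), 0 ≤ S → μ.real (openCrossing halfPlane {v : Site 2 | v 1 = 0 ∧ v 0 ≤ -X} (rowIcc 1 S)) - μ.real {ω : BondConfig (Site 2) | ∃ a b : ℤ, a ≤ -X ∧ 0 ≤ b ∧ b ≤ S ∧ leg a ∈ ω ∧ leg b ∈ ω ∧ ω ∈ openConnIn halfPlane ![a, 0] ![b, 0]} ≤ μ.real {ω : BondConfig (Site 2) | ∃ r : ℤ, 1 ≤ r ∧ r ≤ S ∧ ω ∈ openCrossing halfPlane {v : Site 2 | v 1 = 0 ∧ v 0 ≤ -X} {bpt r} ∧ (∀ r' : ℤ, 1 ≤ r' → r' < r → ω ∉ openCrossing halfPlane {v : Site 2 | v 1 = 0 ∧ v 0 ≤ -X} {bpt r'}) ∧ {b : ℤ | 0 ≤ b ∧ b ≤ S ∧ ω ∈ openConnIn halfPlane (bpt r) (bpt b)}.ncard ≤ M} + μ.real {ω : BondConfig (Site 2) | ∃ r : ℤ, 1 ≤ r ∧ r ≤ S ∧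 ω ∈ openCrossing halfPlane {v : Site 2 | v 1 = 0 ∧ v 0 ≤ -X} {bpt r} ∧ (∀ r' : ℤ, 1 ≤ r' → r' < r → ω ∉ openCrossing halfPlane {v : Site 2 | v 1 = 0 ∧ v 0 ≤ -X} {bpt r'}) ∧ {a : ℤ | -X - W ≤ a ∧ a ≤ -X ∧ ω ∈ openConnIn halfPlane (bpt r) (bpt a)}.ncard ≤ M} + 2 * (1 / 2 : ℝ) ^ (M + 1) := by
  intro X S M W _
  -- `Cross ⊆ Legged ∪ (B_R ∪ B_L)`: if the first-touch cluster has an open leg on the target arc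
  -- and an open leg on the ray window, the configuration is legged
  have hcover : openCrossing halfPlane {v : Site 2 | v 1 = 0 ∧ v 0 ≤ -X} (rowIcc 1 S) ⊆
      {ω : BondConfig (Site 2) | ∃ a b : ℤ, a ≤ -X ∧ 0 ≤ b ∧ b ≤ S ∧ leg a ∈ ω ∧ leg b ∈ ω ∧
          ω ∈ openConnIn halfPlane ![a, 0] ![b, 0]} ∪
        ({ω | ∃ r : ℤ, 1 ≤ r ∧ r ≤ S ∧
            ω ∈ openCrossing halfPlane {v : Site 2 | v 1 = 0 ∧ v 0 ≤ -X} {bpt r} ∧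
            (∀ r' : ℤ, 1 ≤ r' → r' < r →
              ω ∉ openCrossing halfPlane {v : Site 2 | v 1 = 0 ∧ v 0 ≤ -X} {bpt r'}) ∧
            ∀ c : ℤ, 0 ≤ c → c ≤ S → ω ∈ openConnIn halfPlane (bpt r) (bpt c) → leg c ∉ ω} ∪
          {ω | ∃ r : ℤ, 1 ≤ r ∧ r ≤ S ∧
            ω ∈ openCrossing halfPlane {v : Site 2 | v 1 = 0 ∧ v 0 ≤ -X} {bpt r} ∧
            (∀ r' : ℤ, 1 ≤ r' → r' < r →
              ω ∉ openCrossing halfPlane {v : Site 2 | v 1 = 0 ∧ v 0 ≤ -X} {bpt r'}) ∧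
            ∀ c : ℤ, -X - W ≤ c → c ≤ -X → ω ∈ openConnIn halfPlane (bpt r) (bpt c) →
              leg c ∉ ω}) := by
    intro ω hω
    obtain ⟨r, h1, hS, hr, hmin⟩ := LegsThinning.exists_firstTouch hω
    by_cases hb : ∀ b : ℤ, 0 ≤ b → b ≤ S → ω ∈ openConnIn halfPlane (bpt r) (bpt b) → leg b ∉ ω
    · exact Or.inr (Or.inl ⟨r, h1, hS, hr, hmin, hb⟩)
    by_cases ha : ∀ a : ℤ, -X - W ≤ a → a ≤ -X → ω ∈ openConnIn halfPlane (bpt r) (bpt a) →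
        leg a ∉ ω
    · exact Or.inr (Or.inr ⟨r, h1, hS, hr, hmin, ha⟩)
    push Not at ha hb
    obtain ⟨b, hb0, hbS, hrb, hlb⟩ := hb
    obtain ⟨a, -, haX, hra, hla⟩ := ha
    exact Or.inl ⟨a, b, haX, hb0, hbS, hla, hlb,
      PlanarDuality.openConnIn_trans (by rw [openConnIn_comm]; exact hra) hrb⟩
  have key := (measureReal_mono (μ := μ) hcover).trans
    ((measureReal_union_le _ _).trans (add_le_add le_rfl (measureReal_union_le _ _)))
  have hR := LegsThinning.real_allLegsClosed_le {v : Site 2 | v 1 = 0 ∧ v 0 ≤ -X} S 0 S M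
  have hL := LegsThinning.real_allLegsClosed_le {v : Site 2 | v 1 = 0 ∧ v 0 ≤ -X} S (-X - W) (-X) M
  linarith

end Summit.CriticalPhenomena.CardyFormulaZ2.Cruxes.HalfPlaneMarkDensityLaw.SketchLine.SelfDual
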